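import Summits.QuantumFields.YangMills.Theorems.UnitScaleTiltProp8FlatPropagatorProp12
import Summits.QuantumFields.YangMills.Theorems.UnitScaleTiltProp8FlatPropagatorGrad
import HarnessLib

/-!
# Route `UnitScaleTilt`, crux K1 child «MinimiserStabilityRegPr» (stmt-QuantumFields-19200), leaves V2′ (one-step halving, Sect. F) and V3 (Prop. 7):
# **[Balaban1984PropagatorsI] (1.115), THE GLOBAL GRADIENT AND LAPLACIAN ENTRIES `|∇GJ|, |ΔGJ| ≤ O(1)|J|` FOR THE FLAT V1 PROPAGATOR IN SETUP-TORUS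
# LETTERS**, every `Params`, any `a > 0` (the sup-norm operator bounds the contraction of [Balaban1985Variational] Sects. E–F ((115), (143)/(158), (165)) uses)

Cell `ym3-torus` (HUMAN RULING D-0037, YM ladder rung R3), seat `ym3-torus-p1` gen 14 (UV side); memo HOME/UV3-NODE.md §23.  `--supports
stmt-QuantumFields-19200 --as helper`.  Eighth file of pillar F3 «flat-operator bridge» (OWNER RULING g20-№8 §A).  `…FlatPropagatorProp12.abs_GE_le_of_global115`
gives the global FIRST entry `|(Gx)(b)| ≤ C·B`; `…FlatPropagatorGrad.grad_lap_GE_le_of_ineq110` gives the ∇/Δ entries only in the LOCALIZED form (block-supported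
sources).  THIS file reads the GLOBAL ∇/Δ entries of (1.115) (first clause of lit-balaban's `B5.Global115_117` at `n = 1, 3`, via `global115_117_setup`) in V1 letters:
* **`grad_lap_GE_le_of_global115`** — for every real bond field with `|x| ≤ B`, every site `s`, direction `μ`: `L^j·|(Gx)(⟨s+e_ν,μ⟩) − (Gx)(⟨s,μ⟩)| ≤ C·B` for
  all `ν`, and `(L^j)²·|Σ_ν[(Gx)(⟨s,μ⟩) − (Gx)(⟨s+e_ν,μ⟩) + (Gx)(⟨s,μ⟩) − (Gx)(⟨s−e_ν,μ⟩)]| ≤ C·B`;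
* **`exists_GE_sup_grad_lap`** (packaged, every `Params` of dimension `d`, block size `L`, weight `a`: ONE constant for the three global entries) and
  **`exists_GE_sup_grad_lap_T3`** (d = 3 carrier, `j = K − n`).
HONEST SCOPE as in the companions (flat, one level, print's `R` inside (2.19); constants lit-balaban's, functions of `(d, L, a)`).  No definition, no sorry,
standard axioms.  NOT a claim about the mass gap.

References: T. Bałaban, CMP **95** (1984) 17–40 [Balaban1984PropagatorsI] (1.115) p.36; CMP **102** (1985) 277–309 [Balaban1985Variational] (115) p.295, Sect. F (165) p.304.
-/

set_option autoImplicit false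

noncomputable section

open scoped BigOperators InnerProductSpace Matrix ComplexConjugate

namespace Summit.QuantumFields.YangMills.Theorems.FlatPropagatorGradGlobal

open Literature.MathematicalPhysics.QuantumFieldTheory.Balaban1983to89
open Literature.MathematicalPhysics.QuantumFieldTheory.BalabanImbrieJaffe1984to88.BIJ85AxialPropagator411 (BondSpace)
open LatticeFieldCalculus B6SectADomainsV1 B6SectAOperatorsV1 B6SectAVectorModelV1 B6SectCTwoScaleV1 B6GOneLevelV1Bridge
open B5Eq117TorusCarriers (Mk EK)
open B5Eq118OneStroke (iterBlock iterBlockOf mem_iterBlock)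
open B5Prop11Plancherel (Tor fine)
open B5DeltaA169 (DeltaA)
open B5SettingP12Real (LocR latticeSettingP12R gP12R)
open B5Prop12FieldsLattice (cubeB supNormL eL)
open B5Prop11Lower (Lap)
open LatticeNorms (supNorm norm_le_supNorm supNorm_le)
open FlatPropagatorProp12 (EK_mem_cubeT global115_117_setup abs_GE_le_of_global115)
open FlatPropagatorGrad (grad_TV_apply Lap_TV_apply)

variable {P : Params} {j : ℕ}

/-- **(1.115), GRADIENT AND LAPLACIAN ENTRIES, FOR THE V1 PROPAGATOR IN V1 LETTERS** (from the typed block `B5.Global115_117` of b05's real setting at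
`(L^j, Mk P j)`, any `a > 0`): for every real bond field `x` with `|x| ≤ B`, every fine site `s` and direction `μ`:
(∇) `L^j·|(Gx)(⟨s+e_ν,μ⟩) − (Gx)(⟨s,μ⟩)| ≤ C·B` for every `ν`; (Δ) `(L^j)²·|Σ_ν[(Gx)(⟨s,μ⟩) − (Gx)(⟨s+e_ν,μ⟩) + (Gx)(⟨s,μ⟩) − (Gx)(⟨s−e_ν,μ⟩)]| ≤ C·B`.
[cite: Balaban1984PropagatorsI, (1.115) p.36; Balaban1984PropagatorsII, (2.22) p.226] -/
theorem grad_lap_GE_le_of_global115 (hj1 : j + 1 ≤ P.m + P.K) {a : ℝ} (ha : 0 < a)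
    {C : ℝ} (hC : 0 ≤ C) {Cα Cε : ℝ → ℝ} {Cαε : ℝ → ℝ → ℝ}
    (hG : B5.Global115_117 (latticeSettingP12R (P.L ^ j) (Mk P j) a j) (gP12R (Mk P j) (P.L ^ j) a j) C Cα Cε Cαε)
    {w : BondIdx (twoScale j hj1 (∅ : Finset (Site P (j + 1)))) → ℝ}
    (hw : ∀ i, 0 < w i) (hwa : ∀ p, w p = a * ((P.L : ℝ) ^ j) ^ P.d) (x : BondSpace P) {B : ℝ} (hxB : ∀ b', |x b'| ≤ B)
    (s : Site P 0) (μ : Fin P.d) :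
    (∀ ν : Fin P.d,
      (P.L : ℝ) ^ j * |GE (twoScale j hj1 ∅) (c := (P.L : ℝ) ^ j) (pow_ne_zero j (Nat.cast_ne_zero.2 P.L_pos.ne')) hw x ⟨s.shift ν, μ⟩
          - GE (twoScale j hj1 ∅) (c := (P.L : ℝ) ^ j) (pow_ne_zero j (Nat.cast_ne_zero.2 P.L_pos.ne')) hw x ⟨s, μ⟩| ≤ C * B) ∧
    ((P.L : ℝ) ^ j) ^ 2 * |∑ ν : Fin P.d,
        ((GE (twoScale j hj1 ∅) (c := (P.L : ℝ) ^ j) (pow_ne_zero j (Nat.cast_ne_zero.2 P.L_pos.ne')) hw x ⟨s, μ⟩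
            - GE (twoScale j hj1 ∅) (c := (P.L : ℝ) ^ j) (pow_ne_zero j (Nat.cast_ne_zero.2 P.L_pos.ne')) hw x ⟨s.shift ν, μ⟩)
          + (GE (twoScale j hj1 ∅) (c := (P.L : ℝ) ^ j) (pow_ne_zero j (Nat.cast_ne_zero.2 P.L_pos.ne')) hw x ⟨s, μ⟩
            - GE (twoScale j hj1 ∅) (c := (P.L : ℝ) ^ j) (pow_ne_zero j (Nat.cast_ne_zero.2 P.L_pos.ne')) hw x ⟨s.unshift ν, μ⟩))| ≤ C * B := by
  have hj : j ≤ P.m + P.K := Nat.le_of_succ_le hj1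
  have hB : 0 ≤ B := (abs_nonneg _).trans (hxB ⟨s, μ⟩)
  have hLj : 0 ≤ (P.L : ℝ) ^ j := by positivity
  set Jr : Tor (fine (P.L ^ j) (Mk P j)) × Fin P.d → ℝ := fun i => x ⟨(EK hj).symm i.1, i.2⟩ with hJr
  have hemb : (LocR.vec Jr).emb = .vec (TV hj x) := by
    rw [TV_eq_cplx]
    rfl
  set y : Site P j := iterBlockOf j s with hy
  have hs : s ∈ iterBlock j y := (mem_iterBlock j y s).2 rfl
  have hsup : (latticeSettingP12R (P.L ^ j) (Mk P j) a j).supNorm (LocR.vec Jr) ≤ B := by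
    show supNormL (P.L ^ j) (Mk P j) (LocR.vec Jr).emb ≤ B
    rw [hemb]
    show supNorm Finset.univ (TV hj x) ≤ B
    refine supNorm_le hB fun i _ => ?_
    obtain ⟨z, κ⟩ := i
    rw [TV_apply, Complex.norm_real, Real.norm_eq_abs]
    exact hxB _
  have hrhs : C * (latticeSettingP12R (P.L ^ j) (Mk P j) a j).supNorm (LocR.vec Jr) ≤ C * B := mul_le_mul_of_nonneg_left hsup hC
  have hmemB : (EK hj s, μ) ∈ cubeB (P.L ^ j) (Mk P j) y :=
    Finset.mem_product.2 ⟨EK_mem_cubeT hj hs, Finset.mem_univ _⟩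
  have hT := TV_GE_twoScale_empty hj1 hw ha hwa x
  constructor
  · intro ν
    have h := hG.1 1 (LocR.vec Jr) y
    have he : (latticeSettingP12R (P.L ^ j) (Mk P j) a j).e 1 (LocR.vec Jr) y
        = supNorm (Finset.univ ×ˢ cubeB (P.L ^ j) (Mk P j) y)
            (fun p : Fin P.d × (Tor (fine (P.L ^ j) (Mk P j)) × Fin P.d) =>
              B5Prop11Lattice.grad (P.L ^ j) (Mk P j) ((DeltaA (P.L ^ j) (Mk P j) a)⁻¹ *ᵥ TV hj x) p.1 p.2) := by
      show eL (P.L ^ j) (Mk P j) a 1 (LocR.vec Jr).emb y = _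
      rw [hemb]
      rfl
    rw [he, ← hT] at h
    have hmem' : (ν, (EK hj s, μ)) ∈ Finset.univ ×ˢ cubeB (P.L ^ j) (Mk P j) y :=
      Finset.mem_product.2 ⟨Finset.mem_univ ν, hmemB⟩
    have hval := norm_le_supNorm
      (fun p : Fin P.d × (Tor (fine (P.L ^ j) (Mk P j)) × Fin P.d) =>
        B5Prop11Lattice.grad (P.L ^ j) (Mk P j) (TV hj (GE (twoScale j hj1 ∅) (c := (P.L : ℝ) ^ j)
          (pow_ne_zero j (Nat.cast_ne_zero.2 P.L_pos.ne')) hw x)) p.1 p.2) hmem'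
    dsimp only at hval
    rw [grad_TV_apply, Complex.norm_real, Real.norm_eq_abs, abs_mul, abs_of_nonneg hLj] at hval
    exact hval.trans (h.trans hrhs)
  · have h := hG.1 3 (LocR.vec Jr) y
    have he : (latticeSettingP12R (P.L ^ j) (Mk P j) a j).e 3 (LocR.vec Jr) y
        = supNorm (cubeB (P.L ^ j) (Mk P j) y) (Lap (P.L ^ j) (Mk P j) *ᵥ ((DeltaA (P.L ^ j) (Mk P j) a)⁻¹ *ᵥ TV hj x)) := by
      show eL (P.L ^ j) (Mk P j) a 3 (LocR.vec Jr).emb y = _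
      rw [hemb]
      rfl
    rw [he, ← hT] at h
    have hval := norm_le_supNorm
      (Lap (P.L ^ j) (Mk P j) *ᵥ TV hj (GE (twoScale j hj1 ∅) (c := (P.L : ℝ) ^ j)
          (pow_ne_zero j (Nat.cast_ne_zero.2 P.L_pos.ne')) hw x)) hmemB
    rw [Lap_TV_apply, Complex.norm_real, Real.norm_eq_abs, abs_mul, abs_of_nonneg (sq_nonneg _)] at hval
    exact hval.trans (h.trans hrhs)

/-- **PACKAGED — THE THREE GLOBAL SUP-NORM ENTRIES OF (1.115) WITH ONE CONSTANT**, every `Params`: for `d ≥ 1`, odd `L > 1`, `a > 0` there is `C > 0` (function of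
`d, L, a`) such that for every `P` with `P.d = d`, `P.L = L`, every `1 ≤ j`, `j + 1 ≤ m + K`, weights `a·(L^j)^d` and every real bond field with `|x| ≤ B`:
`|(Gx)(b)| ≤ C·B`, `L^j·|∇_ν(Gx)| ≤ C·B`, `(L^j)²·|Δ(Gx)| ≤ C·B` — the sup-norm operator bounds `‖G‖, ‖∇G‖, ‖ΔG‖ = O(1)` the contraction of
[Balaban1985Variational] Sects. E–F uses ((165): «‖G̃‖, ‖H‖ ≤ B₀»). [cite: Balaban1984PropagatorsI, (1.115) p.36; Balaban1985Variational, (165) p.304] -/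
theorem exists_GE_sup_grad_lap (d L : ℕ) (hd : 1 ≤ d) (hL : Odd L ∧ 1 < L) {a : ℝ} (ha : 0 < a) :
    ∃ C : ℝ, 0 < C ∧ ∀ (P : Params), P.d = d → P.L = L → ∀ (j : ℕ), 1 ≤ j → ∀ (hj1 : j + 1 ≤ P.m + P.K)
      (w : BondIdx (twoScale j hj1 (∅ : Finset (Site P (j + 1)))) → ℝ) (hw : ∀ i, 0 < w i),
      (∀ p, w p = a * ((P.L : ℝ) ^ j) ^ P.d) → ∀ (x : BondSpace P) (B : ℝ), (∀ b', |x b'| ≤ B) →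
        (∀ b : PBond P 0,
          |GE (twoScale j hj1 ∅) (c := (P.L : ℝ) ^ j) (pow_ne_zero j (Nat.cast_ne_zero.2 P.L_pos.ne')) hw x b| ≤ C * B) ∧
        (∀ (s : Site P 0) (μ ν : Fin P.d),
          (P.L : ℝ) ^ j * |GE (twoScale j hj1 ∅) (c := (P.L : ℝ) ^ j) (pow_ne_zero j (Nat.cast_ne_zero.2 P.L_pos.ne')) hw x ⟨s.shift ν, μ⟩
              - GE (twoScale j hj1 ∅) (c := (P.L : ℝ) ^ j) (pow_ne_zero j (Nat.cast_ne_zero.2 P.L_pos.ne')) hw x ⟨s, μ⟩| ≤ C * B) ∧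
        (∀ (s : Site P 0) (μ : Fin P.d),
          ((P.L : ℝ) ^ j) ^ 2 * |∑ ν : Fin P.d,
              ((GE (twoScale j hj1 ∅) (c := (P.L : ℝ) ^ j) (pow_ne_zero j (Nat.cast_ne_zero.2 P.L_pos.ne')) hw x ⟨s, μ⟩
                  - GE (twoScale j hj1 ∅) (c := (P.L : ℝ) ^ j) (pow_ne_zero j (Nat.cast_ne_zero.2 P.L_pos.ne')) hw x ⟨s.shift ν, μ⟩)
                + (GE (twoScale j hj1 ∅) (c := (P.L : ℝ) ^ j) (pow_ne_zero j (Nat.cast_ne_zero.2 P.L_pos.ne')) hw x ⟨s, μ⟩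
                  - GE (twoScale j hj1 ∅) (c := (P.L : ℝ) ^ j) (pow_ne_zero j (Nat.cast_ne_zero.2 P.L_pos.ne')) hw x ⟨s.unshift ν, μ⟩))| ≤ C * B) := by
  obtain ⟨C, Cα, Cε, Cαε, hC, h115⟩ := global115_117_setup d L hd hL ha
  refine ⟨C, hC, fun P hPd hPL j hj hj1 w hw hwa x B hxB => ⟨fun b => ?_, fun s μ ν => ?_, fun s μ => ?_⟩⟩
  · exact abs_GE_le_of_global115 hj1 ha hC.le (h115 P hPd hPL j hj) hw hwa x hxB b
  · exact (grad_lap_GE_le_of_global115 hj1 ha hC.le (h115 P hPd hPL j hj) hw hwa x hxB s μ).1 ν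
  · exact (grad_lap_GE_le_of_global115 hj1 ha hC.le (h115 P hPd hPL j hj) hw hwa x hxB s μ).2

section T3

open T3ContinuumYM3Torus (T3Family)
open Prop7FlatCoercivityR (succ_le_T3)

/-- **AT THE d = 3 CARRIER** (`F.L = L`, `n < K`, `j = K − n`, weight `a·(L^{K−n})³`): the three global sup-norm entries of (1.115) for the one-level V1 propagator,
ONE constant depending on `L, a` only. [cite: Balaban1984PropagatorsI, (1.115) p.36; Balaban1985Variational, (165) p.304] -/
theorem exists_GE_sup_grad_lap_T3 (L : ℕ) (hL : Odd L ∧ 1 < L) {a : ℝ} (ha : 0 < a) :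
    ∃ C : ℝ, 0 < C ∧ ∀ (F : T3Family), F.L = L → ∀ (n K : ℕ), n < K →
      ∀ (w : BondIdx (twoScale (K - n) (succ_le_T3 F n K) (∅ : Finset (Site (F.P K) (K - n + 1)))) → ℝ) (hw : ∀ i, 0 < w i),
      (∀ p, w p = a * ((F.L : ℝ) ^ (K - n)) ^ 3) → ∀ (x : BondSpace (F.P K)) (B : ℝ), (∀ b', |x b'| ≤ B) →
        (∀ b : PBond (F.P K) 0,
          |GE (twoScale (K - n) (succ_le_T3 F n K) ∅) (c := ((F.L : ℝ)) ^ (K - n))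
            (pow_ne_zero (K - n) (Nat.cast_ne_zero.2 (F.P K).L_pos.ne')) hw x b| ≤ C * B) ∧
        (∀ (s : Site (F.P K) 0) (μ ν : Fin 3),
          (F.L : ℝ) ^ (K - n) *
            |GE (twoScale (K - n) (succ_le_T3 F n K) ∅) (c := ((F.L : ℝ)) ^ (K - n))
                (pow_ne_zero (K - n) (Nat.cast_ne_zero.2 (F.P K).L_pos.ne')) hw x ⟨s.shift ν, μ⟩
              - GE (twoScale (K - n) (succ_le_T3 F n K) ∅) (c := ((F.L : ℝ)) ^ (K - n))
                (pow_ne_zero (K - n) (Nat.cast_ne_zero.2 (F.P K).L_pos.ne')) hw x ⟨s, μ⟩| ≤ C * B) ∧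
        (∀ (s : Site (F.P K) 0) (μ : Fin 3),
          ((F.L : ℝ) ^ (K - n)) ^ 2 * |∑ ν : Fin 3,
              ((GE (twoScale (K - n) (succ_le_T3 F n K) ∅) (c := ((F.L : ℝ)) ^ (K - n))
                  (pow_ne_zero (K - n) (Nat.cast_ne_zero.2 (F.P K).L_pos.ne')) hw x ⟨s, μ⟩
                - GE (twoScale (K - n) (succ_le_T3 F n K) ∅) (c := ((F.L : ℝ)) ^ (K - n))
                  (pow_ne_zero (K - n) (Nat.cast_ne_zero.2 (F.P K).L_pos.ne')) hw x ⟨s.shift ν, μ⟩)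
              + (GE (twoScale (K - n) (succ_le_T3 F n K) ∅) (c := ((F.L : ℝ)) ^ (K - n))
                  (pow_ne_zero (K - n) (Nat.cast_ne_zero.2 (F.P K).L_pos.ne')) hw x ⟨s, μ⟩
                - GE (twoScale (K - n) (succ_le_T3 F n K) ∅) (c := ((F.L : ℝ)) ^ (K - n))
                  (pow_ne_zero (K - n) (Nat.cast_ne_zero.2 (F.P K).L_pos.ne')) hw x ⟨s.unshift ν, μ⟩))| ≤ C * B) := by
  obtain ⟨C, hC, h⟩ := exists_GE_sup_grad_lap 3 L (by norm_num) hL ha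
  refine ⟨C, hC, fun F hFL n K hnK w hw hwa x B hxB => ?_⟩
  exact h (F.P K) rfl hFL (K - n) (by omega) (succ_le_T3 F n K) w hw hwa x B hxB

end T3

end Summit.QuantumFields.YangMills.Theorems.FlatPropagatorGradGlobal

end
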